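import Mathlib
import HarnessLib
import Literature.Analysis.FluidPDE.Tao2016AveragedNS.LocalCascadeSolutions
import Literature.Analysis.FluidPDE.Tao2016AveragedNS.RenormalisedCascadeWaves
import Literature.Analysis.FluidPDE.Tao2016AveragedNS.SelfSimilarCascadeBlowup
import Literature.Analysis.FluidPDE.Tao2016AveragedNS.SelfSimilarCascadeResidues
import Literature.Analysis.FluidPDE.Tao2016AveragedNS.ViscousEternalSolutions
import Literature.Analysis.FluidPDE.Tao2016AveragedNS.BoundedEternalSolutions
import Summits.NavierStokesRegularity.NavierStokesRegularity.Theorems.TaoLadderRungTwoBreakNoSurvivingEternalViscBddOneSmallActionRung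

/-!
# A two-index residue floor («eternal B′, local form») for admissible eternal solutions
# (helper toward (ρ0) `stub_noSurvivingEternalBddOne` of `TaoLadderRungTwoBreak.NoSurvivingEternalViscBddOne`,
# stmt-NavierStokesRegularity-20419)

MODEL lattice ODEs only (Tao 2016 §4, §6.4; cell vocabulary `IsEternalVisc`, `physEnergy`, `physFlux`, `viscCoef`);
nothing here is a statement about the Navier–Stokes equations; no summit, crux or rung LEAF is proved
(`--supports stmt-NavierStokesRegularity-20419`).

The tree's THEOREM B′ protects the residue of a SELF-SIMILAR front (`ẽ ≤ e^{H}·Rsq`).  For a general admissible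
eternal solution (any covariant viscosity `ν̂ ≥ 0`) the shell energy identity `E_k' = F_{k−1} − F_k − 2·visc_k·E_k`
with `|F_j| ≤ 2C_AΛ⁻¹‖W_{j+1}‖E_j` gives, by an integrating factor on `[σ⋆, σ]`, the **two-index residue floor**
(`physEnergy_ge_residueFloor`):

  `E_k(σ) ≥ e^{−Θ}·E_k(σ⋆) − 2C_AΛ⁻¹·(∫_{σ⋆}^{σ}‖W_k‖)·A`,
  `Θ ≥ ∫_{σ⋆}^{σ}(2C_AΛ⁻¹‖W_{k+1}‖ + 2·visc_k)`,  `A ≥ sup_{[σ⋆,σ]} E_{k−1}`: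

what shell `k` holds at `σ⋆` can only be drained through the bond `k → k+1` (multiplicative factor, the action of
shell `k+1` plus dissipation) or handed BACK to shell `k−1` (additive term, the action of shell `k` against the energy
still present below).  Inviscid specialisation `physEnergy_ge_residueFloor_inviscid` (`Θ = 2C_AΛ⁻¹∫‖W_{k+1}‖`).
With the conveyor inequality of `…SmallActionRung` this is the local building block of an «eternal B′»; it does
NOT by itself give a logarithmic action floor off the self-similar stratum (the additive back-flow term is of the
order of the action, see the census of ⟨20419⟩).
-/

noncomputable section

-- the summit and its single sub-problem share the name (CONVENTIONS §1)
set_option linter.dupNamespace false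

namespace Summit.NavierStokesRegularity.NavierStokesRegularity.Theorems.NoSurvivingEternalViscBddOne.ResidueFloor

open Set Filter Topology MeasureTheory
open scoped RealInnerProductSpace
open Literature.Analysis.FluidPDE Literature.Analysis.FluidPDE.TaoCascade
open Summit.NavierStokesRegularity.NavierStokesRegularity.Theorems.NoSurvivingEternalViscBddOne.SmallAction

variable {m : ℕ} {ε₀ νh : ℝ} {α : Fin m → Fin m → Fin m → ℤ × ℤ × ℤ → ℝ} {W : ℤ → ℝ → Em m}

/-- **Two-index residue floor.**  For an admissible eternal solution (any `ν̂ ≥ 0`) of a cancelling table, a shell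
`k`, log-times `σ⋆ ≤ σ`, a bound `A` of `E_{k−1}` on `[σ⋆, σ]`, a bound `Mk` of `∫_{σ⋆}^{σ}‖W_k‖` and a bound `Θ` of
`∫_{σ⋆}^{σ}(2C_AΛ⁻¹‖W_{k+1}‖ + 2 visc_k)`:  `e^{−Θ}·E_k(σ⋆) − 2C_AΛ⁻¹·Mk·A ≤ E_k(σ)`.
[cite: Tao2016AveragedNS, §4 Lemma 4.1 (4.8)–(4.10) with (4.3), the viscous equation before Thm. 4.2, §6.4; tree `hasDerivAt_physEnergy` + this file] -/
theorem physEnergy_ge_residueFloor (hε : 0 < ε₀) (hW : IsEternalVisc ε₀ νh α W) (hc : IsCancellingCoeff α)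
    (k : ℤ) {σs σ : ℝ} (hle : σs ≤ σ) {A Mk Θ : ℝ}
    (hA : ∀ s ∈ Icc σs σ, physEnergy ε₀ W (k - 1) s ≤ A)
    (hMk : ∫ s in σs..σ, ‖W k s‖ ≤ Mk)
    (hΘ : ∫ s in σs..σ, (2 * fluxConst α * (bigLam ε₀)⁻¹ * ‖W (k + 1) s‖ + 2 * viscCoef ε₀ νh k s) ≤ Θ) :
    Real.exp (-Θ) * physEnergy ε₀ W k σs - 2 * fluxConst α * (bigLam ε₀)⁻¹ * Mk * A
      ≤ physEnergy ε₀ W k σ := by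
  set κ₀ := 2 * fluxConst α * (bigLam ε₀)⁻¹ with hκ₀
  have hΛ : 0 < bigLam ε₀ := bigLam_pos (by linarith)
  have hκ₀nn : 0 ≤ κ₀ := by have := fluxConst_nonneg α; positivity
  -- continuity of the players
  have cWk : Continuous (W k) := continuous_iff_continuousAt.2 fun s => (hW.law k s).continuousAt
  have cWk1 : Continuous (W (k + 1)) := continuous_iff_continuousAt.2 fun s => (hW.law (k + 1) s).continuousAt
  have cE : Continuous (physEnergy ε₀ W k) := continuous_physEnergy hW k
  have cvisc : Continuous fun s => viscCoef ε₀ νh k s := by unfold viscCoef; fun_prop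
  -- the rate `θ ≥ 0` and its primitive `P`
  set θ : ℝ → ℝ := fun s => κ₀ * ‖W (k + 1) s‖ + 2 * viscCoef ε₀ νh k s with hθ
  have cθ : Continuous θ := by simp only [hθ]; fun_prop
  have hθnn : ∀ s, 0 ≤ θ s := fun s =>
    add_nonneg (mul_nonneg hκ₀nn (norm_nonneg _)) (mul_nonneg two_pos.le (viscCoef_nonneg hε hW.nonneg k s))
  set P : ℝ → ℝ := fun u => ∫ x in σs..u, θ x with hP
  have hPderiv : ∀ u, HasDerivAt P (θ u) u := fun u => (cθ.integral_hasStrictDerivAt σs u).hasDerivAt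
  have cP : Continuous P := continuous_iff_continuousAt.2 fun u => (hPderiv u).continuousAt
  have hP0 : P σs = 0 := by simp [hP]
  have hPmono : ∀ s ∈ Icc σs σ, P s ≤ P σ := by
    intro s hs
    have h := intervalIntegral.integral_mono_interval (μ := volume) (f := θ) (c := σs) (d := σ) (a := σs)
      (b := s) le_rfl hs.1 hs.2 (Eventually.of_forall fun x => hθnn x) (cθ.intervalIntegrable _ _)
    simpa [hP] using h
  have hPσ : P σ ≤ Θ := hΘ
  -- the weighted energy `Ψ = e^{P} E_k` and its derivative
  set D : ℝ → ℝ := fun s => physFlux ε₀ α W (k - 1) s - physFlux ε₀ α W k s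
      - 2 * viscCoef ε₀ νh k s * physEnergy ε₀ W k s with hD
  have hEderiv : ∀ s, HasDerivAt (physEnergy ε₀ W k) (D s) s := fun s => hasDerivAt_physEnergy hε hW hc k s
  set Ψ : ℝ → ℝ := fun s => Real.exp (P s) * physEnergy ε₀ W k s with hΨ
  set Ψ' : ℝ → ℝ := fun s => Real.exp (P s) * θ s * physEnergy ε₀ W k s + Real.exp (P s) * D s with hΨ'
  have hΨderiv : ∀ s, HasDerivAt Ψ (Ψ' s) s := by
    intro s
    have h1 : HasDerivAt (fun u => Real.exp (P u)) (Real.exp (P s) * θ s) s := (hPderiv s).exp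
    have h : HasDerivAt (fun u => Real.exp (P u) * physEnergy ε₀ W k u)
        (Real.exp (P s) * θ s * physEnergy ε₀ W k s + Real.exp (P s) * D s) s := h1.mul (hEderiv s)
    exact h
  have cD : Continuous D := by
    have h1 := continuous_physFlux hW hc (k - 1)
    have h2 := continuous_physFlux hW hc k
    simp only [hD]; fun_prop
  have cΨ' : Continuous Ψ' := by
    have : Continuous fun s => Real.exp (P s) := cP.rexp
    simp only [hΨ']; fun_prop
  -- pointwise lower bound of `Ψ'` on `[σ⋆, σ]`
  have hA0 : 0 ≤ A := (physEnergy_nonneg ε₀ W (k - 1) σs).trans (hA σs ⟨le_rfl, hle⟩)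
  set G : ℝ → ℝ := fun s => -(Real.exp (P σ) * (κ₀ * A) * ‖W k s‖) with hG
  have cG : Continuous G := by have := cWk.norm; simp only [hG]; fun_prop
  have hlow : ∀ s ∈ Icc σs σ, G s ≤ Ψ' s := by
    intro s hs
    have hEk := physEnergy_nonneg ε₀ W k s
    have heP : 0 < Real.exp (P s) := Real.exp_pos _
    have hePle : Real.exp (P s) ≤ Real.exp (P σ) := Real.exp_le_exp.2 (hPmono s hs)
    -- `θ E + D ≥ F_{k-1} ≥ -κ₀ ‖W_k‖ E_{k-1} ≥ -κ₀ ‖W_k‖ A`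
    have hFk : physFlux ε₀ α W k s ≤ κ₀ * ‖W (k + 1) s‖ * physEnergy ε₀ W k s := by
      have := (le_abs_self _).trans (abs_physFlux_le hε hc W k s); rw [hκ₀]; linarith
    have hFk1 : -(κ₀ * ‖W k s‖ * A) ≤ physFlux ε₀ α W (k - 1) s := by
      have h1 := (neg_le_abs _).trans (abs_physFlux_le hε hc W (k - 1) s)
      rw [sub_add_cancel] at h1
      have h2 : 2 * fluxConst α * (bigLam ε₀)⁻¹ * ‖W k s‖ * physEnergy ε₀ W (k - 1) s
          ≤ κ₀ * ‖W k s‖ * A := by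
        rw [hκ₀]
        exact mul_le_mul_of_nonneg_left (hA s hs) (mul_nonneg hκ₀nn (norm_nonneg _) |>.trans_eq (by rw [hκ₀]))
      linarith
    have hsum : -(κ₀ * ‖W k s‖ * A) ≤ θ s * physEnergy ε₀ W k s + D s := by
      simp only [hθ, hD]
      nlinarith [mul_nonneg (mul_nonneg two_pos.le (viscCoef_nonneg hε hW.nonneg k s)) hEk]
    have h3 : Real.exp (P s) * (-(κ₀ * ‖W k s‖ * A)) ≤ Real.exp (P s) * (θ s * physEnergy ε₀ W k s + D s) :=
      mul_le_mul_of_nonneg_left hsum heP.le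
    have h4 : Real.exp (P σ) * (κ₀ * A) * ‖W k s‖ ≥ Real.exp (P s) * (κ₀ * ‖W k s‖ * A) := by
      have : 0 ≤ κ₀ * ‖W k s‖ * A := by positivity
      nlinarith
    simp only [hG, hΨ']
    nlinarith
  -- integrate over `[σ⋆, σ]`
  have hftc : ∫ s in σs..σ, Ψ' s = Ψ σ - Ψ σs :=
    intervalIntegral.integral_eq_sub_of_hasDerivAt (fun s _ => hΨderiv s) (cΨ'.intervalIntegrable _ _)
  have hmono : ∫ s in σs..σ, G s ≤ ∫ s in σs..σ, Ψ' s :=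
    intervalIntegral.integral_mono_on hle (cG.intervalIntegrable _ _) (cΨ'.intervalIntegrable _ _) hlow
  have hGint : ∫ s in σs..σ, G s = -(Real.exp (P σ) * (κ₀ * A) * ∫ s in σs..σ, ‖W k s‖) := by
    simp only [hG]
    rw [intervalIntegral.integral_neg, intervalIntegral.integral_const_mul]
  have hGge : -(Real.exp (P σ) * (κ₀ * A) * Mk) ≤ ∫ s in σs..σ, G s := by
    rw [hGint, neg_le_neg_iff]
    exact mul_le_mul_of_nonneg_left hMk (by positivity)
  have hΨs : Ψ σs = physEnergy ε₀ W k σs := by simp [hΨ, hP0]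
  have hΨσ : Ψ σ = Real.exp (P σ) * physEnergy ε₀ W k σ := rfl
  -- `e^{Pσ} E(σ) ≥ E(σ⋆) − e^{Pσ} κ₀ A Mk`, divide by `e^{Pσ}` and use `Pσ ≤ Θ`
  have hkey : physEnergy ε₀ W k σs - Real.exp (P σ) * (κ₀ * A) * Mk ≤ Real.exp (P σ) * physEnergy ε₀ W k σ := by
    rw [← hΨσ, ← hΨs]; linarith
  have heσ : 0 < Real.exp (P σ) := Real.exp_pos _
  have hdiv : Real.exp (-P σ) * physEnergy ε₀ W k σs - κ₀ * A * Mk ≤ physEnergy ε₀ W k σ := by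
    have h := mul_le_mul_of_nonneg_left hkey (Real.exp_pos (-P σ)).le
    have e1 : Real.exp (-P σ) * Real.exp (P σ) = 1 := by rw [← Real.exp_add, neg_add_cancel, Real.exp_zero]
    have e2 : Real.exp (-P σ) * (Real.exp (P σ) * physEnergy ε₀ W k σ) = physEnergy ε₀ W k σ := by
      rw [← mul_assoc, e1, one_mul]
    have e3 : Real.exp (-P σ) * (physEnergy ε₀ W k σs - Real.exp (P σ) * (κ₀ * A) * Mk)
        = Real.exp (-P σ) * physEnergy ε₀ W k σs - κ₀ * A * Mk := by
      calc Real.exp (-P σ) * (physEnergy ε₀ W k σs - Real.exp (P σ) * (κ₀ * A) * Mk)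
          = Real.exp (-P σ) * physEnergy ε₀ W k σs - (Real.exp (-P σ) * Real.exp (P σ)) * ((κ₀ * A) * Mk) := by
            ring
        _ = _ := by rw [e1]; ring
    rw [e2, e3] at h
    exact h
  have hexp : Real.exp (-Θ) ≤ Real.exp (-P σ) := Real.exp_le_exp.2 (by linarith)
  have hEs := physEnergy_nonneg ε₀ W k σs
  calc Real.exp (-Θ) * physEnergy ε₀ W k σs - 2 * fluxConst α * (bigLam ε₀)⁻¹ * Mk * A
      ≤ Real.exp (-P σ) * physEnergy ε₀ W k σs - κ₀ * A * Mk := by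
        rw [hκ₀]; nlinarith [mul_le_mul_of_nonneg_right hexp hEs]
    _ ≤ physEnergy ε₀ W k σ := hdiv

/-- **Inviscid specialisation** (`ν̂ = 0`, the hypothesis class of (ρ0)): with `Mk ≥ ∫_{σ⋆}^{σ}‖W_k‖`,
`Mk1 ≥ ∫_{σ⋆}^{σ}‖W_{k+1}‖` and `A ≥ sup_{[σ⋆,σ]}E_{k−1}`:
`exp(−2C_AΛ⁻¹Mk1)·E_k(σ⋆) − 2C_AΛ⁻¹·Mk·A ≤ E_k(σ)`.
[cite: Tao2016AveragedNS, §4 Lemma 4.1 (4.8)–(4.10) with (4.3), §6.4; this file] -/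
theorem physEnergy_ge_residueFloor_inviscid (hε : 0 < ε₀) (hW : IsEternal ε₀ α W) (hc : IsCancellingCoeff α)
    (k : ℤ) {σs σ : ℝ} (hle : σs ≤ σ) {A Mk Mk1 : ℝ}
    (hA : ∀ s ∈ Icc σs σ, physEnergy ε₀ W (k - 1) s ≤ A)
    (hMk : ∫ s in σs..σ, ‖W k s‖ ≤ Mk) (hMk1 : ∫ s in σs..σ, ‖W (k + 1) s‖ ≤ Mk1) :
    Real.exp (-(2 * fluxConst α * (bigLam ε₀)⁻¹ * Mk1)) * physEnergy ε₀ W k σs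
        - 2 * fluxConst α * (bigLam ε₀)⁻¹ * Mk * A ≤ physEnergy ε₀ W k σ := by
  have hW' : IsEternalVisc ε₀ 0 α W := hW.isEternalVisc
  refine physEnergy_ge_residueFloor hε hW' hc k hle hA hMk ?_
  have hv : ∀ s, viscCoef ε₀ 0 k s = 0 := fun s => by unfold viscCoef; ring
  have hκ₀nn : 0 ≤ 2 * fluxConst α * (bigLam ε₀)⁻¹ := by
    have := fluxConst_nonneg α; have := (bigLam_pos (by linarith : (-1 : ℝ) < ε₀)).le; positivity
  simp only [hv, mul_zero, add_zero]
  rw [intervalIntegral.integral_const_mul]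
  exact mul_le_mul_of_nonneg_left hMk1 hκ₀nn

end Summit.NavierStokesRegularity.NavierStokesRegularity.Theorems.NoSurvivingEternalViscBddOne.ResidueFloor

end
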